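import Summits.RiemannHypothesis.RiemannHypothesis.Theses.LiDirichletAsymptotic
import Summits.RiemannHypothesis.RiemannHypothesis.Theorems.LiDirichletAsymptoticOscPlainChar
import Summits.RiemannHypothesis.RiemannHypothesis.Theorems.LiDirichletAsymptoticOscBmorChar
import HarnessLib

/-!
# RiemannHypothesis / LiDirichletAsymptotic — crux K3χ `LiOscillatoryChar` (deciding): the closer (RH-FREE · GRH-FREE)

RH-FREE · GRH-FREE PROOF-OF-DATA (rung L-P(P1⁺χ)) [rh-li-prover].  Route `Theses/LiDirichletAsymptotic.lean`
(cell `pub/rh-li`, round 5 (iii)), item `LiOscillatoryChar` (stmt-RiemannHypothesis-19628, crux 2, deciding):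
`liOscillatoryChar_proof : Theses.LiDirichletAsymptotic.LiOscillatoryChar`, the registered composition
`LiOscillatoryChar_of_stubs` of the two landed stubs — the tree-constant conjunct `liOscillatoryChar_plain`
(`LiDirichletAsymptoticOscPlainChar.lean`, `n ≥ 10⁴`, remainder `argSRem`) and the BMOR conjunct `liOscillatoryChar_bmor`
(`LiDirichletAsymptoticOscBmorChar.lean`, `n ≥ 900`, remainder `bmorRem` under the named fact `bmor2021_theorem11`, a
hypothesis of the typed statement).  Both rest on the remainder identity of `LiDirichletAsymptoticCharWindow.lean`
(partial summation against `N(t, χ)`, `d/dt charCountMainExact = (2/π) g_χ`) and the every-height remainder bound of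
`LiDirichletAsymptoticCharCount.lean`.  Nothing here bears on the truth of RH or GRH.
-/

noncomputable section

-- D-0017: `Summit.<S>.<S>.…` is the designed namespace of a single-problem summit.
set_option linter.dupNamespace false

namespace Summit.RiemannHypothesis.RiemannHypothesis.Theorems.LiTheory

/-- **Item `LiOscillatoryChar` of route `LiDirichletAsymptotic` — PROVED** (FQ type, by name): the oscillatory window sum
minus its smooth part is at most `charErrOscP q n + (n²/(2T'²))·argSRem q T'` (`n ≥ 10⁴`, tree constants) and, given
BMOR 2021 Thm 1.1, at most `charErrOscB q n + (n²/(2T'²))·bmorRem q T'` (`n ≥ 900`), for every primitive `χ` mod `q > 1`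
and `T' ≥ n²`. -/
theorem liOscillatoryChar_proof :
    Summit.RiemannHypothesis.RiemannHypothesis.Theses.LiDirichletAsymptotic.LiOscillatoryChar :=
  fun q _ χ hχ hq n T' hT' ↦
    ⟨fun hn ↦ liOscillatoryChar_plain q χ hχ hq n T' hT' hn,
      fun hB hn ↦ liOscillatoryChar_bmor q χ hχ hq n T' hT' hB hn⟩

end Summit.RiemannHypothesis.RiemannHypothesis.Theorems.LiTheory

end
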